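import Mathlib
import HarnessLib
import HarnessLib.Audit
import Summits.PneNP.Statement
import Literature.Computability.Complexity.RandomCNF
import Literature.Computability.Complexity.CNF
import Literature.Computability.MetaComplexity.Frege
import HarnessLib.Audit.Status.Attr

/-!
Route: Feige

# Route PneNP/Feige — "random 3-SAT at linear density cannot be refuted in polynomial time"
(probabilistic combinatorics)

## Thesis X (it suffices to show) — Feige's hypothesis, deterministic exactly-sound form, at every
constant density
Words: for every constant Δ > 0 there is NO deterministic polynomial-time algorithm A on (encodings
of) 3-CNFs such
that (i) A(φ) = REFUTE only if φ is unsatisfiable and (ii) for all sufficiently large n,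
Pr_{φ ∼ F₃(n,⌈Δn⌉)}[A(φ) = REFUTE] ≥ 1/2, where F₃(n,m) draws m clauses i.i.d. uniformly from the
8·C(n,3) clauses
on 3 distinct variables (Feige2002 §1.1 Hypothesis 1, deterministic-algorithm weakening;
arXiv:1505.04383 §1).
Lean: ∀ Δ : ℝ, 0 < Δ → Literature.Computability.Complexity.FeigeHypothesis Δ
(item `FeigeThesis`; `FeigeHypothesis`, `randomKCNFAtDensity`, `IsSoundRefuter` have landed in
Literature/Computability/Complexity/RandomCNF.lean; the content sits above the satisfiability
threshold —
`feigeHypothesis_zero` shows small Δ is vacuous.)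

## Assembly X → PneNP — DECIDED at rev 3 by the theorem in this file
`theorem closes (hT : FeigeThesis) (hS : SatMemNPCook) (hF : FirstMomentUnsat) : PneNP` (sorry-free;
axioms
propext / Classical.choice / Quot.sound; Mathlib-only plumbing). If every language of Cook's class
NP Bool is in
P Bool then SAT (∈ NP Bool: support item SatMemNPCook, one line from the landed discharges
NP_bool_eq_holds +
SAT_mem_NP_holds in a Theorems file) has a polynomial-time decider f = SAT.boolIndicator; the same
TM2 machine with
its output identification composed with Equiv.boolNot computes !f, an exactly-sound polynomial-time
refuter; by the
first-moment bound (support item FirstMomentUnsat: Pr[F₃(n,⌈Δn⌉) satisfiable] → 0 for Δ > log 2 /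
log(8/7) ≈ 5.191;
Δ = 6 qualifies since 2 < (8/7)^6) and μ(s) + μ(sᶜ) = 1, it accepts with probability ≥ 1/2 for all
large n —
contradicting FeigeHypothesis 6. Hence the route's open debt toward PneNP is exactly X (target
FeigeThesis) plus the
two provable-now supports; the cruxes are the levers on X: NoShortRefutations (FeigeKimOfek2006 Task
2; implies X via
the glue item NoShortRefutationsImpliesThesis) and its AC⁰-Frege rung
FeigeRandom3cnfHardForDepthDFrege.

Rationale: WHY THIS LINE. widen: probabilistic combinatorics (product measures on 3-CNFs) + proof complexity.
Feige's hypothesis (Feige2002 §1.1 Hypothesis 1; arXiv:1505.04383 §1) is a P≠NP-strength statement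
about a PRODUCT MEASURE, so tools foreign to worst-case complexity apply: first/second-moment and
spectral methods fix where refutation IS easy (m ≥ Õ(n^{3/2}): arXiv:1505.04383 Thm 1 and Thm 3),
while unconditional lower bounds hold for whole proof systems on the same distribution — resolution
2^{Ω(n)} (ChvatalSzemeredi1988; BenSassonWigderson2001 §4.3), SOS degree Ω̃(n) below n^{3/2} clauses
(arXiv:1701.04521 Thm 2), AC⁰-Frege Ω(n^{1+ε_d}) steps (arXiv:2403.02275 Thm 1). The line pushes
these class-by-class impossibility theorems up the ladder whose top is "no short refutations in ANY
sound polynomial-time checkable system" (NoShortRefutations = FeigeKimOfek2006 Task 2), which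
implies X, and X implies PneNP by the deciding theorem `closes` proved in the route file (P = NP ⇒
SAT.boolIndicator is a poly-time decider ⇒ its bit-flip is an exactly-sound refuter accepting
F₃(n,6n) with probability ≥ 1/2 eventually, by the first-moment bound). Imported: Mathlib PMF /
outer measure (first moment), Mathlib TM2 machines (the bit-flip); nothing from statistical physics
(no dictionary to (i)–(ii)).
RANKED CRUXES. #2 FeigeRandom3cnfHardForDepthDFrege — for every depth d, Frege system F, Δ > 5.2 and
polynomial p, Pr_{F₃(n,⌈Δn⌉)}[¬φ has a depth-d F-refutation of size ≤ p(n)] → 0 (why it might fail: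
only Ω(n^{1+ε_d}) steps is known, arXiv:2403.02275 Thm 1 — switching lemmas fix 1−o(1) of the
variables and kill expansion; TC⁰-Frege already refutes F₃(n, n^{1.4}) in polynomial size,
arXiv:1101.3970; sources arXiv:2403.02275, BenSassonWigderson2001 §4.3, Buss1999 §2). #3
NoShortRefutations — for every Δ > 0 no sound polynomial-time verifier V accepts some
polynomial-length witness for at least half of F₃(n,⌈Δn⌉) (why it might fail: it is average-case NP
≠ coNP at density Δ; polynomial-size witnesses exist whp at m ≥ c·n^{7/5}, FeigeKimOfek2006 =
doi:10.1109/focs.2006.78, even as TC⁰-Frege proofs, MullerTzameret2014 = arXiv:1101.3970; nothing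
known separates n^{1.4} from Δn). Target #0 FeigeThesis (X). Support (rank 9, unranked for
staffing): NoShortRefutationsImpliesThesis (#3 → X; ~100 lines: a deterministic refuter is a
verifier ignoring its witness), SatMemNPCook (SAT ∈ NP Bool; one line from NP_bool_eq_holds +
SAT_mem_NP_holds), FirstMomentUnsat (Pr[F₃(n,⌈Δn⌉) satisfiable] → 0 for Δ > log 2 / log(8/7);
~300–500 lines of PMF counting), FeigeNegation (¬X at some Δ; believed false — the kill test, rank
4).
KILL CRITERIA. FeigeNegation proved (one exactly-sound polynomial-time refuter at ONE constant
density) refutes the target and closes the route. ¬FeigeRandom3cnfHardForDepthDFrege (a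
polynomial-size depth-d Frege refutation of F₃(n,Δn) whp) does not refute X (proofs need not be
findable) but removes the proof-complexity lever: pivot to NoShortRefutations directly, or retire.
¬NoShortRefutations (FKO06-type witnesses pushed from n^{7/5}·n down to linear density) leaves X
formally open but kills this line's mechanism: retire as exhausted unless a uniform
(algorithm-specific) argument is on the table.
NOT DECOMPOSED YET. k > 3 and the m ≈ n^{k/2} scale; semirandom models; the Res(k) / cutting-planes
/ polynomial-calculus rungs between resolution and depth-2 Frege (natural children of #2 once a rung
closes, via a glued split); the derivation X ⇒ hardness-of-approximation consequences (Feige's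
original motivation) is not needed for PneNP. REMOVED at rev 3 (route-repair): the Alekhnovich
sparse-LPN item FeigeAlekhnovichSparseLpn — it reaches only the ε-sound FeigeHypothesisEps via
Feige's 3XOR principle (Feige2002 §3; Alekhnovich2003 Thm 4.1), is itself a P≠NP-strength CONJECTURE
(Alekhnovich2003 Conjecture 1), not a provable support statement, and was the sole carrier of the
OneWayFunctions / Indistinguishability / SparseLPN imports whose open named facts (OWFExist,
WeakOWFExist, IOOWFExist, NonuniformOWFExist, PRGExist) made the cone unstaffable; that line belongs
in a separate CONDITIONAL-BRIDGE route (--conditional-on AlekhnovichHypothesis, cruxes: the 3XOR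
principle to FeigeHypothesisEps and an ε-sound assembly under P = NP via max-sat ≤ (7/8 + o(1))·m
whp). Also removed: the rev-1 bridged Assembly item (hypotheses P_bool_eq / NP_bool_eq / SAT_mem_NP
were unlisted Literature facts) — superseded by the proved deciding theorem. needs-fact: none.
CHEAPEST FALSIFIER. The AOW15 spectral/SOS refuter analysed at m = Δn: it certifies nothing below
Õ(n^{3/2}) clauses (arXiv:1505.04383 Thm 3) and degree-Õ(1) SOS provably fails at linear density
(arXiv:1701.04521 Thm 2, Rem. 1), so no cheap computation kills X today; the cheapest live kills are
(a) a literature hit pushing FeigeKimOfek2006's nondeterministic witnesses (m > c·n^{7/5},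
doi:10.1109/focs.2006.78 p.498) or MullerTzameret2014's TC⁰-Frege refutations (arXiv:1101.3970) down
to linear density — refutes NoShortRefutations / crux #2 at once — and (b) `lit frontier PneNP`
watch on arXiv:2403.02275's stated open problem.
SOURCES. Feige2002; arXiv:1505.04383; arXiv:1701.04521; arXiv:2403.02275; arXiv:1101.3970;
doi:10.1109/focs.2006.78; BenSassonWigderson2001; ChvatalSzemeredi1988; Alekhnovich2003; Buss1999;
CookReckhow1979; Cook1971; CookClay2006.

Novelty: NOVELTY (retriage planner 2026-08-14; searched before claiming: `lit search` ×4 incl. --hybrid, `lit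
frontier PneNP --since 2020`, `lit bridges PneNP --cross any`, `lit read` of arXiv:2403.02275
pp.1–5, doi:10.1109/focs.2006.78 p.1, KrajicekProofComplexity2019 PDF p.465; OpenAlex/S2/arXiv APIs
were rate-limited, local store + Crossref + zbMATH answered).
Nearest prior art — every mathematical ingredient of the route is in print:
- Thesis X is Feige2002 §1.1 Hypothesis 1 (p.535; deterministic, exactly-sound weakening — the
informal's "Hypothesis 2" is a mis-cite recorded by the grounder), and "P = NP kills X" is Feige2002
p.534's first-moment remark ((7/8)^Δ < 1/2, i.e. Δ > 5.19) plus SAT ∈ P; the Assembly is that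
folklore observation at Δ = 6, nothing more.
- Crux FeigeRandom3cnfHardForDepthDFrege is verbatim the "major open problem in proof complexity" of
arXiv:2403.02275 (abstract), whose Thm 1 (Ω(n^{1+ε_k}) steps for depth-k Frege at Cn clauses) is the
only rung above Res(k); lower rungs: resolution ChvatalSzemeredi1988 / BenSassonWigderson2001 §4.3
(Def 4.18 = the tree's with-repetition clause model), Res(√log n), PC, CP for O(log n)-CNF as listed
in arXiv:2403.02275 §1; upper side doi:10.1109/focs.2006.78 (witnesses at m > c·n^{7/5}) and
arXiv:1101.3970 (TC⁰-Frege refutations at n^{1.4}).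
- Support FeigeAlekhnovichSparseLpn is Alekhnovich2003 §4 Conjecture 1 in the constant-advantage
sparse-LPN rendering of ApplebaumBarakWigderson2010; calibration of the easy regime by a  [refs: 10.1109/focs.2006.78, 2403.02275, 1101.3970, 1505.04383, 1701.04521, 2604.04188, 2510.02944, doi:10.1109/focs.2006.78, KrajicekProofComplexity2019, Feige2002, ChvatalSzemeredi1988, BenSassonWigderson2001, Alekhnovich2003, ApplebaumBarakWigderson2010]

Barriers (technique_class: average-case-refutation,switching-lemma,ac0-frege,sparse-lpn): technique_class: average-case-refutation,switching-lemma,ac0-frege,sparse-lpn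
- Literature.Barriers.PneNP.Relativization (with Literature.Barriers.PneNP.BoundedRelativization and
Literature.Barriers.PneNP.Algebrization): APPLY to the target and are relocated, not evaded. The
Assembly relativizes (P^O = NP^O yields an exactly-sound poly-time refuter relative to O, and the
first-moment bound is oracle-free), so X fails relative to every oracle with P^O = NP^O and any
proof of X must be non-relativizing (likewise non-PSPACE-relativizing, non-algebrizing). The route
names no non-relativizing ingredient; the bet is that a lower bound for a PRODUCT MEASURE on 3-CNFs
is reached through combinatorial / proof-complexity structure (crux
FeigeRandom3cnfHardForDepthDFrege) invisible to oracle arguments. Honest status: it does not evade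
them.
- Literature.Barriers.PneNP.NaturalProofs : applies to the non-uniform reading of X (no sound P/poly
refuter), which implies NP ⊄ P/poly; the typed X is uniform
(Literature.Computability.Complexity.IsPolyTimePred) but nothing in the route exploits uniformity,
so a constructive-and-large combinatorial proof of X is blocked given 2^{k^ε}-hard PRGs
(RazborovRudich1997 Thm 4.1). It does NOT apply to the crux: AC⁰-Frege lower bounds (Ajtai1988,
KrajicekPudlakWoods1995, PitassiBeameImpagliazzo1993, Pitassi–Rossman–Servedio–Tan 2016 and Håstad
2021 for Tseitin) are switching-lemma proofs against a class with no pseudorandom functions.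
- Literature.Barriers.

History (route lifecycle, newest last):
- 2026-08-15T16:27:41Z · rev 3: restated Assembly (stmt-PneNP-0297) — route-repair rev 3 (glue + cone guardrail): (1) deciding theorem PROVED — closes : FeigeThesis → SatMemNPCook → FirstMomentUnsat → PneNP, sorry-free, axioms pro (planner-rbadge-PneNP-Feige-78fcb92a-g2-0)
- 2026-08-15T16:27:41Z · rev 3: dropped FeigeAlekhnovichSparseLpn — route-repair rev 3 (glue + cone guardrail): (1) deciding theorem PROVED — closes : FeigeThesis → SatMemNPCook → FirstMomentUnsat → PneNP, sorry-free, axioms pro (planner-rbadge-PneNP-Feige-78fcb92a-g2-0)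
- 2026-08-16T04:14:01Z · AUTO-CRUX (backfill): FeigeThesis — hypotheses of the deciding theorem that nothing in the route derives are cruxes (operator:999:1085951)
- 2026-08-16T16:39:47Z · AUTO-CRUX (backfill): SatMemNPCook, FirstMomentUnsat — hypotheses of the deciding theorem that nothing in the route derives are cruxes (operator:999:1813213)

sub-problem: PneNP · status: open · opened planner-PneNP-Survey-0 2026-08-13T06:09:48Z · rev 4 · ledger route-PneNP-Feige
GENERATED by the gate from the ledger (D-0016/17). Provers cite these decls: `theorem foo : Summit.PneNP.PneNP.Theses.Feige.<Decl> := …` in Summits/PneNP/PneNP/Theorems/<Name>.lean.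
-/

namespace Summit.PneNP.PneNP.Theses.Feige

open scoped BigOperators Topology Manifold Classical MeasureTheory ProbabilityTheory Matrix InnerProductSpace ComplexConjugate ContinuousMap
open Filter Set Function TopologicalSpace MeasureTheory

attribute [summit_statement] _root_.PneNP

open Literature.PNP

/-- item stmt-PneNP-0296 · crux (kind.auto-crux: conjecture-grade) · rank 0 · open · by planner
why it might fail: X ⇒ P≠NP, and X dies if ONE sound poly-time refuter works at ONE constant Δ: poly-size UNSAT witnesses already exist at m ≥ c·n^1.4 (FKO06; in TC⁰-Frege, Müller–Tzameret 2014), below the algorithmic Õ(n^1.5) threshold (AOW15 Thm 3); n^1.5 is a proved barrier only for SOS/spectral (KMOW17 Thm 2).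
sources: Feige2002 §1.1 Hypothesis 1 (p.535; Hyp. 2 in the informal is a mis-cite), arXiv:1505.04383 Thm 3 and p.3 ('improving n^{3/2} is a major open problem [ABW10]'), arXiv:1701.04521 Thm 2 (= STOC Thm 1.2) and Rem. 1, doi:10.1109/focs.2006.78 (Feige–Kim–Ofek 2006) p.1: witnesses at m > c n^{7/5}, arXiv:1101.3970 = doi:10.1016/j.apal.2014.08.001 (Müller–Tzameret 2014); KrajicekProofComplexity2019 PDF p.465
For every constant Δ > 0 there is no deterministic polynomial-time algorithm A on (encodings of)
3-CNFs such that (i) A(φ) = REFUTE only if φ is unsatisfiable and (ii) for all sufficiently large n,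
Pr_{φ ∼ F₃(n,⌈Δn⌉)}[A(φ) = REFUTE] ≥ 1/2, where F₃(n,m) draws m clauses i.i.d. uniformly among the
8·C(n,3) width-3 clauses on n variables (Feige, STOC 2002, Hypothesis 2, deterministic-algorithm
weakening; restated in Allen–O'Donnell–Witmer arXiv:1505.04383 §1). Intended Lean shape: ∀ Δ : ℝ, 0
< Δ → FeigeHypothesis Δ. NEEDS DEFINITION: randomKCNF (ensemble F_k(n,m) over
Literature.Computability.Complexity.CNF ℕ / encodingCNF) and FeigeHypothesis (Δ : ℝ) : Prop.
[sources: arXiv:1505.04383; arXiv:1701.04521] [route PneNP/Feige, rank 0] -/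
@[route_item "route-PneNP-Feige", crux]
def FeigeThesis : Prop :=
  ∀ Δ : ℝ, 0 < Δ → Literature.Computability.Complexity.FeigeHypothesis Δ

/-- item stmt-PneNP-0298 · crux · rank 2 · open · by planner
why it might fail: Only Ω(n^{1+ε_d}) steps is known (arXiv:2403.02275 Thm 1): AC⁰-Frege switching lemmas fix 1−o(1) of the variables, killing a random 3-CNF's expansion (ibid. §1); short proofs are not excluded — TC⁰-Frege refutes F₃(n, n^1.4) in poly size (Müller–Tzameret 2014); nothing known forbids depth-d at Δn.
sources: arXiv:2403.02275 abstract, Thm 1 (p.5), §1 'Obstacles for 3-CNFs' (p.3), BenSassonWigderson2001 §4.3 Def 4.18–Cor 4.20 (resolution rung; ChvatalSzemeredi1988), arXiv:1101.3970 (Müller–Tzameret 2014, TC⁰-Frege upper bound at n^{1.4}); KrajicekProofComplexity2019 PDF p.465, Buss1999 §2 (depth-d Frege); CookReckhow1979 §2, tree: Literature.Computability.MetaComplexity.FregeSystem.IsDepthProofOf, boundedDepthFrege_pigeonhole_lowerBound (ProofComplexity.lean), RandomCNFResolution.lean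
For every depth d, every Frege system F (Literature.Computability.MetaComplexity.FregeSystem,
IsFrege F), every Δ > 5.2 and every polynomial p: Pr_{φ ∼ F₃(n,⌈Δn⌉)}[∃ π, F.IsDepthProofOf d π (¬φ
as a PropForm) ∧ proofSize π ≤ p(n)] → 0 as n → ∞. Known for resolution (2^{Ω(n)}, Chvátal–Szemerédi
1988; Ben-Sasson–Wigderson 2001 §6) and for polynomial calculus / SOS degree; OPEN for depth-2 Frege
and above (Buss 1999 §2 for the depth-d systems). Hardest and most informative crux: it is the
proof-complexity shadow of the thesis on the same product measure. NEEDS DEFINITION: randomKCNF (as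
above); CNF-to-PropForm translation of ¬φ (check Literature.Computability.Complexity.PropForm.ofCNF
exists). [sources: BenSassonWigderson2001; Buss1999; arXiv:1701.04521] [route PneNP/Feige, rank 2] -/
@[route_item "route-PneNP-Feige"]
def FeigeRandom3cnfHardForDepthDFrege : Prop :=
  ∀ (F : Literature.Computability.MetaComplexity.FregeSystem), Literature.Computability.MetaComplexity.IsFrege F → ∀ (d : ℕ) (Δ : ℝ), (5.2 : ℝ) < Δ → ∀ p : Polynomial ℕ, Filter.Tendsto (fun n : ℕ => (Literature.Computability.Complexity.randomKCNFAtDensity 3 Δ n).toOuterMeasure {φ | ∃ π : List (Literature.Computability.Complexity.PropForm ℕ), F.IsDepthProofOf d π (Literature.Computability.Complexity.PropForm.neg (Literature.Computability.Complexity.PropForm.ofCNF φ)) ∧ Literature.Computability.MetaComplexity.proofSize π ≤ p.eval n}) Filter.atTop (nhds 0)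

/-- item stmt-PneNP-1118 · crux · rank 3 · open · by planner
why it might fail: It is average-case NP≠coNP at density Δ: false outright if NP = coNP (Δ > 5.19), and poly-size witnesses already exist whp at m ≥ c·n^{7/5} (FeigeKimOfek2006; as TC⁰-Frege proofs, MullerTzameret2014), below the algorithmic n^{3/2} — nothing known separates n^{1.4} from Δn.
sources: FeigeKimOfek2006 §1 p.497 (Task 2 'Nondeterministic refutation'; 'deterministic refutation is at least as hard'), p.498 (main result: witnesses whp for m > c·n^{7/5}, i.e. density n^{2/5}; 'pushing either of these densities down is an interesting question') = doi:10.1109/focs.2006.78, MullerTzameret2014 = arXiv:1101.3970 = doi:10.1016/j.apal.2014.08.001 (polynomial-size TC⁰-Frege refutations of F₃(n, n^{1.4})), arXiv:2403.02275 abstract + Thm 1 (AC⁰-Frege rung: Ω(n^{1+ε_d}) steps only; superpolynomial open), Feige2002 §1.1 Hypothesis 1 (p.535) (deterministic form = the thesis X), BenSassonWigderson2001 §4.3 / ChvatalSzemeredi1988 (resolution rung 2^{Ω(n)})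
[crux] Feige–Kim–Ofek's Task 2 (NONDETERMINISTIC refutation) is infeasible at every constant
density: for every Δ > 0 there is no polynomial-time predicate V (IsPolyTimePred, the Statement's
machine model) on pairs boolPair (encodingCNF.encode φ) π that is SOUND (accepts only if φ is
unsatisfiable) and, for some polynomial p and all large n, accepts SOME witness π with |π| ≤ p(n)
for at least half of φ ∼ F₃(n,⌈Δn⌉). Equivalently: whp a random 3-CNF at linear density has no
polynomial-size refutation in ANY sound poly-time-checkable system — the top of the ladder whose
AC⁰-Frege rung is FeigeRandom3cnfHardForDepthDFrege; it implies the thesis X (glue item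
NoShortRefutationsImpliesThesis: a deterministic refuter is a verifier ignoring its witness) and is
the average-case NP ≠ coNP statement at density Δ (FeigeKimOfek2006 p.498: 'co-NP ⊂ NP for densities
above n^{2/5} … pushing either of these densities down is an interesting question'). Content only
above the satisfiability threshold (as for FeigeHypothesis); witness length polynomial in n. WHY IT
MIGHT FAIL: it is average-case NP≠coNP — false outright if NP = coNP (Δ > 5.19), and poly-size
witnesses already exist whp at m ≥ c·n^{7/5 -/
@[route_item "route-PneNP-Feige"]
def NoShortRefutations : Prop :=
  ∀ Δ : ℝ, 0 < Δ → ¬ ∃ V : List Bool → Bool, Literature.Computability.Complexity.IsPolyTimePred V ∧ (∀ (φ : Literature.Computability.Complexity.CNF ℕ) (π : List Bool), V (Literature.Computability.Complexity.boolPair (Literature.Computability.Complexity.encodingCNF.encode φ) π) = true → ¬ Literature.Computability.Complexity.CNF.Satisfiable φ) ∧ ∃ p : Polynomial ℕ, ∀ᶠ n : ℕ in Filter.atTop, (1 / 2 : ENNReal) ≤ (Literature.Computability.Complexity.randomKCNFAtDensity 3 Δ n).toOuterMeasure {φ | ∃ π : List Bool, π.length ≤ p.eval n ∧ V (Literature.Computability.Complexity.boolPair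 (Literature.Computability.Complexity.encodingCNF.encode φ) π) = true}

/-- item stmt-PneNP-1086 · crux (kind.auto-crux: conjecture-grade) · rank 9 · closed · proved by Summit.PneNP.PneNP.Theorems.feige_satMemNPCook_proof @ 08103fff5481 (prover) · by planner
why it might fail: auto-crux — summit-strength (notes:refuter-rreview1-PneNP-Feige-78fcb92a-0): the deciding theorem assumes it and nothing in the route derives it, so it is a bet, not glue
sources: Cook1971 Thm 1, CookClay2006 §1 (NP via checking relations), AroraBarakCC2009 Def. 2.1; tree: NP_bool_eq_holds (ClayProblemProofs), SAT_mem_NP_holds (NegCNFTranscoder)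
[support] SAT ∈ NP in Cook's checking-relation form over Option Bool — the summit Statement's own
class Literature.Computability.Complexity.PNPWave0.NP (pnp.S08), not the prelude's
Nondeterministic.NP. Known result, provable in ONE line from landed discharges: `rw
[NP_bool_eq_holds]; exact SAT_mem_NP_holds` (ClayProblemProofs.NP_bool_eq_holds, NegCNFTranscoder's
SAT_mem_NP_holds; checked by the planner in Sketch2.lean, rc 0). Filed so that a Wave0-side Assembly
`SatMemNPCook → FirstMomentUnsat → FeigeThesis → PneNP` (route-repair rev 2, pending an authorized
`route edit`: see retriage note) lets the ROUTE file import only CNF.lean + PNPWave0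
(conjecture-free cone) while the proof's Theorems file imports the bridge modules. [sources:
Cook1971 Thm 1; CookClay2006 §1; AroraBarakCC2009 Def. 2.1; tree: NP_bool_eq_holds,
SAT_mem_NP_holds] -/
@[route_item "route-PneNP-Feige", crux]
def SatMemNPCook : Prop :=
  Literature.Computability.Complexity.SAT ∈ Literature.Computability.Complexity.PNPWave0.NP Bool

/-- item stmt-PneNP-1099 · crux (kind.auto-crux: conjecture-grade) · rank 9 · closed · proved by Summit.PneNP.PneNP.Theorems.feige_firstMomentUnsat_proof @ 292cde75161a (prover) · by planner
why it might fail: auto-crux — summit-strength (notes:refuter-rreview1-PneNP-Feige-78fcb92a-0): the deciding theorem assumes it and nothing in the route derives it, so it is a bet, not glue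
sources: Feige2002 p.534 (first-moment remark (7/8)^Δ < 1/2), BenSassonWigderson2001 §4.3 (Chvátal–Szemerédi form)
[support] First-moment bound, provable with Mathlib PMF + counting (~300–500 lines): for Δ > log 2 /
log(8/7) ≈ 5.191, Pr_{φ ∼ F₃(n,⌈Δn⌉)}[φ satisfiable] → 0 (randomKCNFAtDensity 3 Δ n,
CNF.Satisfiable; limit in ℝ≥0∞). Proof: clauses in kClauses 3 n use variables < n, so Satisfiable ⇔
some τ : Fin n → Bool satisfies φ (2^n candidates); for fixed τ a uniform clause from kClauses 3 n
(n ≥ 3; (S, ε) ↦ clauseOf S ε is injective, 8·C(n,3) clauses) is violated with probability exactly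
1/8 (one sign pattern per variable triple); the ⌈Δn⌉ draws are independent (randomKCNF = uniform law
on Fin m → kClauses pushed to a list), so Pr[τ ⊨ φ] = (7/8)^⌈Δn⌉ and the union bound gives Pr[sat] ≤
2^n (7/8)^{Δn} = exp(−n (Δ·log(8/7) − log 2)) → 0. Δ = 6 qualifies (log 2 / log(8/7) < 6 ⇔ 2 <
(8/7)^6, checked in the planner's Sketch.lean). This is the probabilistic half of ANY assembly
FeigeHypothesis Δ → PneNP (current bridged Assembly or the Wave0-side restatement pending an
authorized route edit). Feige2002 p.534: 'when Δ is a large enough constant (satisfying (7/8)^Δ <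
1/2) then almost surely a random 3CNF formula is not satisfiable'. Junk regime n < 3 (empty clause
set, PMF.pure []) is irrelevant to -/
@[route_item "route-PneNP-Feige", crux]
def FirstMomentUnsat : Prop :=
  ∀ Δ : ℝ, Real.log 2 / Real.log (8 / 7) < Δ → Filter.Tendsto (fun n : ℕ => (Literature.Computability.Complexity.randomKCNFAtDensity 3 Δ n).toOuterMeasure {φ | Literature.Computability.Complexity.CNF.Satisfiable φ}) Filter.atTop (nhds 0)

/-- item stmt-PneNP-0300 · support · rank 4 · open · by planner
why it might fail: Believed FALSE (it is ¬X): every known sound refuter needs m ≥ Õ(n^{3/2}) clauses (AOW15 Thm 3; 'improving n^{3/2} is a major open problem', p.3) and poly-time SOS provably fails at m = Δn (KMOW17 Thm 2, Rem. 1); a Lean proof would also need an explicit TM2 poly-time witness.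
sources: arXiv:1505.04383 Thm 3, p.3, arXiv:1701.04521 Thm 2, Rem. 1, Feige2002 p.534–535
∃ Δ > 0 and a deterministic polynomial-time A with (i) A(φ) = REFUTE ⇒ φ unsatisfiable and (ii)
Pr_{F₃(n,⌈Δn⌉)}[A = REFUTE] ≥ 1/2 for all large n. Negative side staffed on purpose: current
spectral/SOS refuters need m ≥ C n^{3/2} clauses [arXiv:1505.04383, Thm 1; lower bound
arXiv:1701.04521, Thm 1.1]. Settling it either kills route Feige or certifies the density gap. NEEDS
DEFINITION: randomKCNF, FeigeHypothesis. [sources: arXiv:1505.04383; arXiv:1701.04521] [route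
PneNP/Feige, rank 4] -/
@[route_item "route-PneNP-Feige"]
def FeigeNegation : Prop :=
  ∃ Δ : ℝ, 0 < Δ ∧ ¬ Literature.Computability.Complexity.FeigeHypothesis Δ

/-- item stmt-PneNP-1119 · support · rank 9 · closed · proved by Summit.PneNP.PneNP.Theorems.feige_noShortRefutationsImpliesThesis_proof @ ff24fa90fc65 (prover) · by planner
sources: FeigeKimOfek2006 §1 (p.497: 'deterministic refutation is at least as hard as nondeterministic refutation')
[support] glue, provable now (~100 lines of TM plumbing): fix Δ > 0 and a deterministic refuter f
violating FeigeHypothesis Δ (IsPolyTimePred f, IsSoundRefuter f, acceptance ≥ 1/2 eventually); the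
verifier V := f ∘ fstF (V (boolPair x π) = f x by boolUnpair_boolPair / fstF_boolPair) is
polynomial-time (fstF_mem_FP, comp_mem_FP, isPolyTimePred_iff / polyTimeComputable_iff_nonempty),
sound, and with witness bound p := 0 its acceptance set {φ | ∃ π, |π| ≤ 0 ∧ V (boolPair (encode φ)
π) = true} contains {φ | f (encode φ) = true}, so (monotonicity of toOuterMeasure + Eventually.mono)
it violates NoShortRefutations at Δ. Hence NoShortRefutations (crux rank 3) implies the thesis
FeigeThesis pointwise in Δ. FeigeKimOfek2006 §1 (p.497): 'Clearly, deterministic refutation is at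
least as hard as nondeterministic refutation'. [sources: FeigeKimOfek2006 §1] -/
@[route_item "route-PneNP-Feige"]
def NoShortRefutationsImpliesThesis : Prop :=
  NoShortRefutations → FeigeThesis

-- earlier Assembly (stmt-PneNP-0297, replaced 2026-08-15T16:27:41Z -> stmt-PneNP-10872): retired by None — Literature.Computability.Complexity.P_bool_eq → Literature.Computability.Complexity.NP_bool_eq → Literature.Computability.Complexity.SAT_mem_NP → (∀ Δ : ℝ, 0 < Δ → Literature.Computability.Complexity.FeigeHypothesis Δ) → PneNP
/-- item stmt-PneNP-10872 · assembly · rank 1 · closed · proved by Summit.PneNP.PneNP.Theorems.feige_assembly_proof @ c93395da820c (prover) · by planner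
[assembly] SatMemNPCook → FirstMomentUnsat → FeigeThesis → PneNP: SAT ∈ NP Bool (Cook's
checking-relation class of the Statement), the first-moment bound (Pr[F₃(n,⌈Δn⌉) satisfiable] → 0
for Δ > log 2 / log(8/7) ≈ 5.191) and Feige's hypothesis at every Δ > 0 imply P ≠ NP: under P = NP,
SAT.boolIndicator is a polynomial-time decider, its bit-flip (same TM2 machine, output
identification composed with Equiv.boolNot) is an exactly-sound polynomial-time refuter, and at Δ =
6 (2 < (8/7)^6) it accepts with probability ≥ 1/2 for all large n since μ(s) + μ(sᶜ) = 1 —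
contradicting FeigeHypothesis 6. RESTATED at rev 3 (route-repair) over listed items only (the rev-1
form took the Literature bridge facts P_bool_eq / NP_bool_eq / SAT_mem_NP as hypotheses); it is the
content of the route's proved deciding theorem `closes` (this file), so a Theorems file closes it in
one line: `theorem assembly : Feige.Assembly := fun hS hF hT => Feige.closes hT hS hF`. [sources:
Feige2002 p.534–535; CookClay2006 §1; Cook1971 Thm 1] -/
@[route_item "route-PneNP-Feige"]
def Assembly : Prop :=
  SatMemNPCook → FirstMomentUnsat → FeigeThesis → PneNP

/-! D-0027 §2.1 — DECIDING THEOREM (planner-authored via `route open/edit --closes-file`; by planner-rbadge-PneNP-Feige-78fcb92a-g2-0 2026-08-15T16:27:41Z):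
its hypotheses are this route's items and its conclusion the sub-problem Statement (glue_lint), and it elaborates with this file. -/

/-- DECIDING THEOREM (D-0027 §2.1) of route PneNP/Feige: the thesis X (`FeigeThesis`, Feige 2002 §1 Hypothesis 1 in
deterministic form) together with the two provable-now support items `SatMemNPCook` (SAT ∈ NP, Cook's checking-relation
class of the Statement) and `FirstMomentUnsat` (first-moment bound: F₃(n,⌈Δn⌉) is whp unsatisfiable for
Δ > log 2 / log (8/7)) implies `PneNP`. Proof: if every NP language is in P then SAT has a polynomial-time decider
`f = SAT.boolIndicator`; running the same machine with the output-alphabet identification composed with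
`Equiv.boolNot` computes `!f`, a polynomial-time SOUND refuter (`mem_SAT_iff`); at density Δ = 6 (> 5.191, since
2 < (8/7)^6) it accepts with probability ≥ 1/2 for all large n (PMF complement identity μ s + μ sᶜ = 1), contradicting
`FeigeThesis 6`. Uses only Mathlib + the definitions the items are stated over. [Feige2002 p.534–535; CookClay2006 §1] -/
@[closes "route-PneNP-Feige"] theorem closes (hT : FeigeThesis) (hS : SatMemNPCook) (hF : FirstMomentUnsat) : _root_.PneNP := by
  by_contra hne
  simp only [PneNP, Literature.PNP.PNeNP, not_exists, not_and, not_not] at hne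
  -- P = NP gives a polynomial-time decider `f` of SAT, and `f` is the indicator of SAT
  obtain ⟨f, hf, hfL⟩ := hne _ hS
  have hfind : f = Set.boolIndicator Literature.Computability.Complexity.SAT := by
    funext w
    rcases h : f w with _ | _
    · exact ((Set.notMem_iff_boolIndicator _ w).1 (fun hw => by simpa [h] using (hfL w).1 hw)).symm
    · exact ((Set.mem_iff_boolIndicator _ w).1 ((hfL w).2 h)).symm
  subst hfind
  -- swap the output bit: same machine, output alphabet identification composed with `Equiv.boolNot`
  have hnot : ∀ g : List Bool → Bool, Literature.Computability.Complexity.IsPolyTimePred g →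
      Literature.Computability.Complexity.IsPolyTimePred (fun w => !g w) := by
    rintro g ⟨M⟩
    have hb : ∀ b : Bool,
        (M.outputAlphabet.trans Equiv.boolNot).invFun (!b) = M.outputAlphabet.invFun b :=
      fun b => by cases b <;> rfl
    exact ⟨{ tm := M.tm, inputAlphabet := M.inputAlphabet,
              outputAlphabet := M.outputAlphabet.trans Equiv.boolNot, time := M.time,
              outputsFun := fun a => by
                convert M.outputsFun a using 2
                show [_] = [_]
                simp only [hb] }⟩
  have hg := hnot _ hf
  -- the refuter "accept iff the SAT-decider rejects" is sound
  have hsound : Literature.Computability.Complexity.IsSoundRefuter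
      (fun w => !Set.boolIndicator Literature.Computability.Complexity.SAT w) := by
    intro φ hφ hsat
    have hφ' : Set.boolIndicator Literature.Computability.Complexity.SAT
        (Literature.Computability.Complexity.encodingCNF.encode φ) = false := by simpa using hφ
    exact (Set.notMem_iff_boolIndicator _ _).2 hφ'
      ((Literature.Computability.Complexity.mem_SAT_iff φ).2 hsat)
  -- density 6 is above the first-moment threshold log 2 / log (8/7) ≈ 5.19 (2 < (8/7)^6)
  have hlog : Real.log 2 / Real.log (8 / 7) < (6 : ℝ) := by
    have h87 : (0 : ℝ) < Real.log (8 / 7) := Real.log_pos (by norm_num)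
    rw [div_lt_iff₀ h87]
    have h2 : Real.log 2 < Real.log ((8 / 7) ^ 6) := Real.log_lt_log (by norm_num) (by norm_num)
    rw [Real.log_pow] at h2
    push_cast at h2
    linarith
  -- whp the formula is unsatisfiable …
  have hev : ∀ᶠ n : ℕ in Filter.atTop,
      (Literature.Computability.Complexity.randomKCNFAtDensity 3 (6 : ℝ) n).toOuterMeasure
        {φ | Literature.Computability.Complexity.CNF.Satisfiable φ} ≤ 1 / 2 :=
    (hF 6 hlog).eventually (ge_mem_nhds (ENNReal.half_pos one_ne_zero))
  -- … and a PMF gives complementary events total mass 1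
  have hcompl : ∀ (q : PMF (Literature.Computability.Complexity.CNF ℕ))
      (s : Set (Literature.Computability.Complexity.CNF ℕ)),
      q.toOuterMeasure s + q.toOuterMeasure sᶜ = 1 := by
    intro q s
    rw [PMF.toOuterMeasure_apply, PMF.toOuterMeasure_apply, ← ENNReal.tsum_add, ← q.tsum_coe]
    refine tsum_congr fun x => ?_
    have := congrFun (Set.indicator_self_add_compl s (⇑q)) x
    simpa only [Pi.add_apply] using this
  -- the acceptance event of the refuter is exactly "unsatisfiable"
  have hset : {φ : Literature.Computability.Complexity.CNF ℕ |
      (!Set.boolIndicator Literature.Computability.Complexity.SAT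
        (Literature.Computability.Complexity.encodingCNF.encode φ)) = true} =
      {φ | Literature.Computability.Complexity.CNF.Satisfiable φ}ᶜ := by
    ext φ
    simp only [Set.mem_setOf_eq, Set.mem_compl_iff, Bool.not_eq_true']
    rw [← Set.notMem_iff_boolIndicator]
    exact not_congr (Literature.Computability.Complexity.mem_SAT_iff φ)
  -- so the refuter accepts with probability ≥ 1/2 for all large n, contradicting Feige's hypothesis at Δ = 6
  refine hT 6 (by norm_num)
    ⟨fun w => !Set.boolIndicator Literature.Computability.Complexity.SAT w, hg, hsound, ?_⟩
  filter_upwards [hev] with n hn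
  rw [hset]
  by_contra hlt
  push Not at hlt
  have hsum := ENNReal.add_lt_add_of_le_of_lt (ne_top_of_le_ne_top (by simp) hn) hn hlt
  rw [hcompl, ENNReal.add_halves] at hsum
  exact lt_irrefl _ hsum

end Summit.PneNP.PneNP.Theses.Feige
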